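import Summits.CriticalPhenomena.CardyFormulaZ2.Theorems.CardyIKTransportCornerLineDescentOfCornerIrrelevance
import Summits.CriticalPhenomena.CardyFormulaZ2.Theorems.CardyIKTransportCornerLineDescentDomainPerturbation
import Summits.CriticalPhenomena.CardyFormulaZ2.Theorems.CardyIKTransportCornerLineDescentRiemannMapPlaneExtension
import Summits.CriticalPhenomena.CardyFormulaZ2.Theorems.CardyIKTransportCornerLineDescentTameShrink
import Summits.CriticalPhenomena.CardyFormulaZ2.Theorems.CardyIKTransportCornerLineDescentCornerIrrelevanceAt

/-!
# Cardy for crude bond-`ℤ²` crossings passes from TAME rectangles to all conformal rectangles; the crux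
# `CardyIKTransport.CornerLineDescent` (stmt-CriticalPhenomena-10964) closed modulo the two TAME influence stubs

Support file (`--supports stmt-CriticalPhenomena-10964`) for the line `symmetric-seed-second-order`, lead c4 reshape
(checked skeleton `Cruxes/CornerLineDescent/Lines/symmetric_seed_second_order.lean`).  Vocabulary of
`Theorems/CardyIKTransportCornerLineDescentLine.lean` (`gaugeCrossingProb`, `bondStdCrossingProb`, `InfluenceBoundOn`,
`DiluteBoundOn`, `SyndromeBiasAt`, `pIK`, `cornerLineDescent_iff`).

A conformal rectangle `R` is called TAME here when its carrier is the image of the unit disc under a map univalent on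
a LARGER disc — `∃ G r, 1 < r ∧ DifferentiableOn ℂ G (ball 0 r) ∧ InjOn G (ball 0 r) ∧ R.carrier = G '' ball 0 1`
(analytic boundary; written out inline throughout, it is the hypothesis of the line's two registered physics stubs
`stub_SummedInfluenceTame` / `stub_DiluteInfluenceTame`).

* §1 `crudeBondCardy_of_tame` — UNCONDITIONAL, pure bond-`ℤ²` + complex analysis: if the crude standard bond-`ℤ²`
  crossing probabilities satisfy Cardy's formula in every tame rectangle, they satisfy it in every conformal rectangle.
  Given `R`, a uniformizing datum `(φ, x)` and `ε`: the Riemann map `φ ∘ cayley⁻¹ : 𝔻 → R` extends to a plane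
  homeomorphism `F` (`stub_RiemannMapPlaneExtension`, p126030: Carathéodory + Schoenflies); the conjugated shrink
  `T = F ∘ (λ·) ∘ F⁻¹` is `η`-close to the identity near `closure R`, `R.map T = F(λ𝔻)` is tame and `(T ∘ φ, x)`
  uniformizes it with the SAME `x` (`stub_TameShrink`, p126288); and crude crossing probabilities of `R.map T` and `R`
  differ by `≤ ε` for all small meshes (`stub_DomainPerturbation`: Schramm–Smirnov (5.1) at the chart quad of a square
  model + the fat/thin sandwiches for `R` and `R.map T`).  So `bondStdCrossingProb R δ → cardyFunction (crossRatio x)`.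
* §2 The crux modulo the two tame stubs (`cornerLineDescent_of_tameStubs`): `CardyIK` (the crux's hypothesis, all `R`)
  + the tame summed/dilute influence bounds + the per-rectangle Russo plumbing `stub_CornerIrrelevanceAt` (p126377) give
  Cardy for the frozen gauge at every tame `R`; tameness is invariant under `z ↦ c z` (`tame_map_mulLeft₀`), so the
  unconditional frozen-end comparison (`freezeComparisonAt`, p125041) gives Cardy for crude standard bond-`ℤ²` at every
  tame `R`; §1 finishes.  With both stubs proved (or filed as `@[conjecture]` items of a conditional bridge) the crux
  closes by `exact cornerLineDescent_of_tameStubs h₁ h₂`.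

References: route file `Theses/CardyIKTransport.lean` (item 10964); O. Schramm, S. Smirnov, Ann. Probab. 39 (2011)
§5; Ch. Pommerenke, *Boundary Behaviour of Conformal Maps* (1992), Thm. 2.6, Cor. 2.9, §3.1.
-/

noncomputable section

namespace Summit.CriticalPhenomena.CardyFormulaZ2.Theorems.CornerLineDescent.SymmetricSeed

open scoped Topology
open Filter Set
open Literature.Probability.RandomPlanarGeometry

/-! ## §1 Crude bond Cardy: tame rectangles suffice -/

/-- CRUDE BOND-`ℤ²` CARDY PASSES FROM TAME RECTANGLES TO ALL CONFORMAL RECTANGLES (unconditional).  If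
`bondStdCrossingProb R δ → cardyFunction η(R)` for every conformal rectangle `R` whose carrier is `G(𝔻)` with `G`
univalent on a larger disc, then the same holds for every conformal rectangle: perturb `R` to the tame `R.map T` with the
same modulus datum `x` (`stub_RiemannMapPlaneExtension`, `stub_TameShrink`) inside the `η` of `stub_DomainPerturbation`,
and pass to the limit up to `2ε/3`. [folklore] -/
theorem crudeBondCardy_of_tame
    (hT : ∀ R : ConformalRectangle,
      (∃ G : ℂ → ℂ, ∃ r : ℝ, 1 < r ∧ DifferentiableOn ℂ G (Metric.ball 0 r) ∧ Set.InjOn G (Metric.ball 0 r) ∧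
        R.carrier = G '' Metric.ball 0 1) →
      R.HasCrossingLimit (bondStdCrossingProb R) cardyFunction) :
    ∀ R : ConformalRectangle, R.HasCrossingLimit (bondStdCrossingProb R) cardyFunction := by
  intro R φ x hφx
  rw [Metric.tendsto_nhds]
  intro ε hε
  obtain ⟨η, hη, hpert⟩ := stub_DomainPerturbation R (ε / 3) (by positivity)
  obtain ⟨F, hF⟩ := stub_RiemannMapPlaneExtension R.toJordanDomain (cayley.symm.trans φ)
  obtain ⟨T, hclose, htame, ψ, hψ⟩ := stub_TameShrink R φ x hφx F hF η hη
  have hlim : Tendsto (bondStdCrossingProb (R.map T)) (𝓝[>] 0) (𝓝 (cardyFunction (crossRatio x))) :=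
    hT (R.map T) htame ψ x hψ
  rw [Metric.tendsto_nhds] at hlim
  filter_upwards [hpert T hclose, hlim (ε / 3) (by positivity)] with δ h1 h2
  rw [Real.dist_eq] at h2 ⊢
  calc |bondStdCrossingProb R δ - cardyFunction (crossRatio x)|
      ≤ |bondStdCrossingProb (R.map T) δ - bondStdCrossingProb R δ| +
          |bondStdCrossingProb (R.map T) δ - cardyFunction (crossRatio x)| := by
        rw [abs_sub_comm (bondStdCrossingProb (R.map T) δ) (bondStdCrossingProb R δ)]
        exact abs_sub_le _ _ _
    _ < ε := by linarith

/-! ## §2 The crux modulo the two tame influence stubs -/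

/-- Tameness is invariant under the dilation-rotations `z ↦ c z`, `c ≠ 0` (take `c · G`). [folklore] -/
theorem tame_map_mulLeft₀ {R : ConformalRectangle}
    (h : ∃ G : ℂ → ℂ, ∃ r : ℝ, 1 < r ∧ DifferentiableOn ℂ G (Metric.ball 0 r) ∧ Set.InjOn G (Metric.ball 0 r) ∧
      R.carrier = G '' Metric.ball 0 1)
    {c : ℂ} (hc : c ≠ 0) :
    ∃ G : ℂ → ℂ, ∃ r : ℝ, 1 < r ∧ DifferentiableOn ℂ G (Metric.ball 0 r) ∧ Set.InjOn G (Metric.ball 0 r) ∧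
      (R.map (Homeomorph.mulLeft₀ c hc)).carrier = G '' Metric.ball 0 1 := by
  obtain ⟨G, r, hr, hG, hinj, hcar⟩ := h
  refine ⟨fun z => c * G z, r, hr, hG.const_mul c, fun z hz w hw hzw => hinj hz hw (mul_left_cancel₀ hc hzw), ?_⟩
  rw [MarkedDomain.carrier_map, hcar, Set.image_image]
  rfl

/-- FROZEN-GAUGE CARDY AT EVERY TAME RECTANGLE, from the crux's hypothesis `CardyIK` and the two tame influence bounds:
rate-free corner irrelevance at `R` (`stub_CornerIrrelevanceAt`) transfers the `P_IK` limit to the frozen gauge. [folklore] -/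
theorem gaugeZeroCardyAt_of_tameStubs
    (hsum : ∀ R : ConformalRectangle,
      (∃ G : ℂ → ℂ, ∃ r : ℝ, 1 < r ∧ DifferentiableOn ℂ G (Metric.ball 0 r) ∧ Set.InjOn G (Metric.ball 0 r) ∧
        R.carrier = G '' Metric.ball 0 1) →
      ∃ θ C c₀ : ℝ, 0 < θ ∧ 0 < c₀ ∧ ∀ᶠ δ in 𝓝[>] (0:ℝ), InfluenceBoundOn R θ C c₀ δ)
    (hdil : ∀ R : ConformalRectangle,
      (∃ G : ℂ → ℂ, ∃ r : ℝ, 1 < r ∧ DifferentiableOn ℂ G (Metric.ball 0 r) ∧ Set.InjOn G (Metric.ball 0 r) ∧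
        R.carrier = G '' Metric.ball 0 1) →
      ∀ c : ℝ, 0 < c → ∃ C κ : ℝ, 0 < κ ∧ ∀ᶠ δ in 𝓝[>] (0:ℝ), DiluteBoundOn R c C κ δ)
    (hIK : ∀ R : ConformalRectangle, R.HasCrossingLimit (gaugeCrossingProb pIK R) cardyFunction)
    {R : ConformalRectangle}
    (hR : ∃ G : ℂ → ℂ, ∃ r : ℝ, 1 < r ∧ DifferentiableOn ℂ G (Metric.ball 0 r) ∧ Set.InjOn G (Metric.ball 0 r) ∧
      R.carrier = G '' Metric.ball 0 1) :
    R.HasCrossingLimit (gaugeCrossingProb 0 R) cardyFunction := by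
  intro φ x hφx
  have h0 := stub_CornerIrrelevanceAt R (hsum R hR) (hdil R hR)
  have h3 := (hIK R φ x hφx).sub h0
  simp only [sub_sub_cancel, sub_zero] at h3
  exact h3

/-- CRUDE STANDARD BOND CARDY AT EVERY TAME RECTANGLE (same hypotheses): transport a datum of the tame `R` to the tame
`e^{-iπ/4} R` (`tame_map_mulLeft₀`, `Freeze.exists_isUniformizing_map_mulLeft₀`), apply `gaugeZeroCardyAt_of_tameStubs`
there, and pull back through the unconditional frozen-end comparison (`Freeze.freezeHomogenisationAt_of_comparisonAt` ∘
`freezeComparisonAt`). [folklore] -/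
theorem bondStdCardyAt_of_tameStubs
    (hsum : ∀ R : ConformalRectangle,
      (∃ G : ℂ → ℂ, ∃ r : ℝ, 1 < r ∧ DifferentiableOn ℂ G (Metric.ball 0 r) ∧ Set.InjOn G (Metric.ball 0 r) ∧
        R.carrier = G '' Metric.ball 0 1) →
      ∃ θ C c₀ : ℝ, 0 < θ ∧ 0 < c₀ ∧ ∀ᶠ δ in 𝓝[>] (0:ℝ), InfluenceBoundOn R θ C c₀ δ)
    (hdil : ∀ R : ConformalRectangle,
      (∃ G : ℂ → ℂ, ∃ r : ℝ, 1 < r ∧ DifferentiableOn ℂ G (Metric.ball 0 r) ∧ Set.InjOn G (Metric.ball 0 r) ∧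
        R.carrier = G '' Metric.ball 0 1) →
      ∀ c : ℝ, 0 < c → ∃ C κ : ℝ, 0 < κ ∧ ∀ᶠ δ in 𝓝[>] (0:ℝ), DiluteBoundOn R c C κ δ)
    (hIK : ∀ R : ConformalRectangle, R.HasCrossingLimit (gaugeCrossingProb pIK R) cardyFunction)
    {R : ConformalRectangle}
    (hR : ∃ G : ℂ → ℂ, ∃ r : ℝ, 1 < r ∧ DifferentiableOn ℂ G (Metric.ball 0 r) ∧ Set.InjOn G (Metric.ball 0 r) ∧
      R.carrier = G '' Metric.ball 0 1) :
    R.HasCrossingLimit (bondStdCrossingProb R) cardyFunction := by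
  intro φ x hφx
  have hc : Complex.exp (((Real.pi / 4 : ℝ) : ℂ) * Complex.I) ≠ 0 := Complex.exp_ne_zero _
  obtain ⟨ψ, hψ⟩ := Freeze.exists_isUniformizing_map_mulLeft₀ R hc hφx
  exact Freeze.freezeHomogenisationAt_of_comparisonAt (freezeComparisonAt R) _
    (gaugeZeroCardyAt_of_tameStubs hsum hdil hIK (tame_map_mulLeft₀ hR hc) ψ x hψ)

/-- THE CRUX MODULO THE TWO TAME INFLUENCE STUBS (lead c4 composition; ANCHOR).  The registered statements
`stub_SummedInfluenceTame` and `stub_DiluteInfluenceTame` (second-order summed influence of the corner seed in the dense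
window, and the dilute-window bound, both for conformal rectangles with analytic boundary) imply
`CardyIKTransport.CornerLineDescent` by name: the `SyndromeBiasAt` antecedent is the landed `stub_SyndromeBias`
(p89215), Cardy for crude bond-`ℤ²` at tame rectangles is `bondStdCardyAt_of_tameStubs`, and tame rectangles suffice
by `crudeBondCardy_of_tame`. [folklore] -/
theorem cornerLineDescent_of_tameStubs :
    ((∀ p : ℝ, 0 < p → p < 1 → ∃ C : ℝ, SyndromeBiasAt p C) →
      ∀ R : ConformalRectangle,
        (∃ G : ℂ → ℂ, ∃ r : ℝ, 1 < r ∧ DifferentiableOn ℂ G (Metric.ball 0 r) ∧ Set.InjOn G (Metric.ball 0 r) ∧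
          R.carrier = G '' Metric.ball 0 1) →
        ∃ θ C c₀ : ℝ, 0 < θ ∧ 0 < c₀ ∧ ∀ᶠ δ in 𝓝[>] (0:ℝ), InfluenceBoundOn R θ C c₀ δ) →
    (∀ R : ConformalRectangle,
      (∃ G : ℂ → ℂ, ∃ r : ℝ, 1 < r ∧ DifferentiableOn ℂ G (Metric.ball 0 r) ∧ Set.InjOn G (Metric.ball 0 r) ∧
        R.carrier = G '' Metric.ball 0 1) →
      ∀ c : ℝ, 0 < c → ∃ C κ : ℝ, 0 < κ ∧ ∀ᶠ δ in 𝓝[>] (0:ℝ), DiluteBoundOn R c C κ δ) →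
    Summit.CriticalPhenomena.CardyFormulaZ2.Theses.CardyIKTransport.CornerLineDescent := by
  intro hsum hdil
  rw [cornerLineDescent_iff]
  intro hIK
  exact crudeBondCardy_of_tame fun R hR => bondStdCardyAt_of_tameStubs (hsum stub_SyndromeBias) hdil hIK hR

end Summit.CriticalPhenomena.CardyFormulaZ2.Theorems.CornerLineDescent.SymmetricSeed
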